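import Literature.NumberTheory.EllipticCurves.SkinnerUrban2014.SelmerCorankOfVanishingLValueProofs
import Literature.NumberTheory.EllipticCurves.BSDRankResidualCellsProofs
import Literature.NumberTheory.EllipticCurves.BSDRankZeroDensity
import Literature.NumberTheory.EllipticCurves.BSDSelmerCMPConverseRankOneProofs
import HarnessLib

/-!
# Trivial `p`-Selmer group ⇒ rank `0` AND analytic rank `0`, at every `p ≥ 3` of good ordinary
# reduction with (irr) + (ram) — the `Sel^(p)`-currency form of Skinner–Urban's Thm. 3.6.11 (b),
# in particular at `p = 3` (cell `b2b-bsdres`, unit `b2b-bsdres-x10` = X10 / N2 lane, GEN 28; GLUE —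
# theorems only, no definition, no named fact of its own, nothing booked)

HONEST FRAMING (run/shared/lean/b2b/bsd-rank1-residual/, verbatim in every file): the goal of the
cell is to DELETE the COMBINATION-SHAPED residual classes of the Birch–Swinnerton-Dyer formula for
ALL analytic-rank `≤ 1` elliptic curves over `ℚ` — "full BSD formula for every rank `≤ 1` curve in
class `C`" assembled STRICTLY from published theorems — so that the rank-`≤ 1` remainder becomes
exactly the CONSTRUCTION-SHAPED classes, which are TYPED (missing-input `Prop`s), NOT attempted.
This is not "finishing BSD". This file is GLUE for the BSD-DENSITY sprint's lever (γ) «a second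
prime `p = 3`» (HOME `cells/density/CONVERSION-QUEUE.md` v0 §3; x10's readiness note
`b2b-bsdres-x10/g28/out/GAMMA-P3-READINESS-x10g28.md`): nothing is priced or booked here; no mark,
tier or count of any residual class moves; the N2 class (X10b @ 3) is untouched and carries no mass.

## What

The density counts consume per-curve class theorems in the currency of the `p`-SELMER GROUP
`Sel^(p)(E/ℚ) ⊆ H¹(ℚ, E[p])` (what Bhargava–Shankar's averages control), e.g. the binder `h5` of
`bsz_rankLeOne_cRank_of_pieces`: `#Sel^(5)(E) = 1 ⟹ rank E(ℚ) = 0 ∧ ord_{s=1} L(E,s) = 0`. The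
tree's converse theorems speak the `p^∞`-SELMER CORANK currency. This file supplies the bridge and
the composed statement, for every `p ≥ 3` along the Skinner–Urban route (so that `p = 3` is allowed):

* `rank_zero_of_selmerGroup_eq_bot` — `Sel^(p)(E/ℚ) = 0 ⟹ rank E(ℚ) = 0 ∧ Ш(E/ℚ)[p^∞] = 0 ∧
  corank_{ℤ_p} Sel_{p^∞}(E/ℚ) = 0`, NO named fact (Kummer sequence + Nakayama, tree
  `mordellWeilRank_eq_zero_and_torsionBy_eq_bot_of_selmerGroup_eq_bot`; `Ш[p]` is the image of
  `Sel^(p)`, tree `map_torsionH1ToH1_selmerGroup_holds`; a `p`-primary group without `p`-torsion is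
  trivial, tree `primaryComponent_sha_eq_bot_of_inf_torsionBy_eq_bot`; corank identity
  `selmerCorank_eq_mordellWeilRank_of_finite_shaPrimary`);
* `rank_zero_and_analyticRank_zero_of_selmerGroup_eq_bot_of_skinnerUrban` — for `E/ℚ` with
  globally minimal model `W`, `p ≥ 3` good ordinary, `E[p]` irreducible, (ram) (a multiplicative
  prime `ℓ ≠ p` with `p ∤ v_ℓ(Δ_min)`): `Sel^(p)(E/ℚ) = 0 ⟹ rank E(ℚ) = 0 ∧ ord_{s=1} L(E,s) = 0 ∧
  Ш(E/ℚ)[p^∞] = 0`, below the named facts `skinner_urban_main_conjecture` (bsd.S21 = A16, its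
  RATIONAL clause (2) only — registry tier PUB at `p ≥ 5`, PUB* at `p = 3` with flag
  `SU14-12.3.6-mu@nonsplit@3`) and `exists_isNewformOf` (modularity), via the tree theorem
  `SkinnerUrban2014.analyticRank_eq_zero_of_selmerCorank_eq_zero_of_mainConjecture` (p238343);
* `rank_zero_and_analyticRank_zero_of_natCard_selmerGroup_eq_one_of_skinnerUrban` — the same from
  `#Sel^(p)(E/ℚ) = 1` (the binder currency), and `…_three` — the `p = 3` instance displayed.

Not claimed: finiteness of ALL of `Ш(E/ℚ)` (that is Gross–Zagier–Kolyvagin / Kato at analytic rank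
`0`, the separate binder `hGZK` of the counts); anything at `p = 2`; anything for the N2 class
(there (ram@3) fails identically). Axioms: the standard three.

References: C. Skinner, E. Urban, Invent. Math. 195 (2014) Thm. 3.6.9 (p. 45), Thm. 3.6.11 (b)
(p. 46) [SkinnerUrban2014]; M. Bhargava, A. Shankar, Ann. of Math. 181 (2015) Thm. 4 and §4.1
[BhargavaShankarTernary2015]; J. H. Silverman, *AEC* Thm. X.4.2 [SilvermanAEC2009]; R. Greenberg,
LNM 1716 §1 [GreenbergLNM1716].
-/

set_option autoImplicit false

noncomputable section

open scoped Classical MatrixGroups ModularForm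

open CongruenceSubgroup WeierstrassCurve Literature.NumberTheory.EllipticCurves
  Literature.NumberTheory.EllipticCurves.ModularForms

namespace Summit.BirchSwinnertonDyer.Rank1Residual.X10.RankZeroOfTrivialPSelmer

/-! ### §1. `Sel^(p) = 0` ⇒ rank `0`, `Ш[p^∞] = 0`, corank `0` — no named fact -/

/-- **Trivial `p`-Selmer group ⇒ rank `0`, `Ш(E/ℚ)[p^∞] = 0` and `corank_{ℤ_p} Sel_{p^∞}(E/ℚ) = 0`**,
for every elliptic curve over `ℚ` and every prime `p`, with NO named fact: rank `0` and
`E(ℚ)[p] = 0` by the Kummer sequence and Nakayama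
(`mordellWeilRank_eq_zero_and_torsionBy_eq_bot_of_selmerGroup_eq_bot`); `Ш[p] = im Sel^(p) = 0`
(`map_torsionH1ToH1_selmerGroup_holds`, Silverman X.4.2(a)), hence `Ш[p^∞] = 0`
(`primaryComponent_sha_eq_bot_of_inf_torsionBy_eq_bot`); and the corank identity
`corank Sel_{p^∞} = rank` for finite `Ш[p^∞]` (`selmerCorank_eq_mordellWeilRank_of_finite_shaPrimary`).
[cite: SilvermanAEC2009, Thm. X.4.2 (a)] [cite: GreenbergLNM1716, §1 (exact sequence, PDF p. 59)] -/
theorem rank_zero_of_selmerGroup_eq_bot (W : WeierstrassCurve ℚ) [W.IsElliptic] (p : ℕ)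
    [Fact p.Prime] (h : W.selmerGroup p = ⊥) :
    W.mordellWeilRank = 0 ∧ AddCommGroup.primaryComponent W.sha p = ⊥ ∧ W.selmerCorank p = 0 := by
  have hp0 : (p : ℤ) ≠ 0 := by exact_mod_cast (Fact.out : p.Prime).ne_zero
  have hrank : W.mordellWeilRank = 0 :=
    (mordellWeilRank_eq_zero_and_torsionBy_eq_bot_of_selmerGroup_eq_bot W p h).1
  -- `Ш[p] = im (Sel^(p) → H¹(ℚ, E)) = 0`
  have hsha : (W.sha ⊓ AddSubgroup.torsionBy W.galH1 (p : ℤ) : AddSubgroup W.galH1) = ⊥ := by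
    rw [← map_torsionH1ToH1_selmerGroup_holds W hp0, h, AddSubgroup.map_bot]
  have hprim : AddCommGroup.primaryComponent W.sha p = ⊥ :=
    primaryComponent_sha_eq_bot_of_inf_torsionBy_eq_bot W p hsha
  have hfin : Finite (AddCommGroup.primaryComponent W.sha p) := by
    rw [hprim]; infer_instance
  refine ⟨hrank, hprim, ?_⟩
  rw [selmerCorank_eq_mordellWeilRank_of_finite_shaPrimary W p hfin, hrank]

/-- The `#Sel^(p) = 1` form (the currency of the density binders): `#Sel^(p)(E/ℚ) = 1 ⟹
rank E(ℚ) = 0 ∧ Ш(E/ℚ)[p^∞] = 0 ∧ corank_{ℤ_p} Sel_{p^∞}(E/ℚ) = 0`. [cite: SilvermanAEC2009, Thm. X.4.2 (a)] -/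
theorem rank_zero_of_natCard_selmerGroup_eq_one (W : WeierstrassCurve ℚ) [W.IsElliptic] (p : ℕ)
    [Fact p.Prime] (h : Nat.card (W.selmerGroup p) = 1) :
    W.mordellWeilRank = 0 ∧ AddCommGroup.primaryComponent W.sha p = ⊥ ∧ W.selmerCorank p = 0 := by
  have hbot : W.selmerGroup p = ⊥ := by
    haveI := (Nat.card_eq_one_iff_unique.mp h).1
    exact (W.selmerGroup p).eq_bot_of_subsingleton
  exact rank_zero_of_selmerGroup_eq_bot W p hbot

/-! ### §2. With Skinner–Urban at `p ≥ 3`: analytic rank `0` as well -/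

/-- **Trivial `p`-Selmer group ⇒ rank `0` AND analytic rank `0` (and `Ш[p^∞] = 0`), `p ≥ 3`, along
Skinner–Urban.** For `E/ℚ` with globally minimal model `W` and a prime `p ≥ 3` of good ordinary
reduction (`hgood`, `hord : p ∤ a_p`) with `E[p]` irreducible (`hirr`) and S–U's (ram) (`haux`: a
prime `ℓ ≠ p` of multiplicative reduction with `p ∤ v_ℓ(Δ_min)`, the binder of bsd.S21 verbatim):
`Sel^(p)(E/ℚ) = 0 ⟹ rank E(ℚ) = 0 ∧ ord_{s=1} L(E,s) = 0 ∧ Ш(E/ℚ)[p^∞] = 0`. §1 gives rank `0`,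
`Ш[p^∞] = 0`, corank `0` fact-free; Skinner–Urban 2014 Thm. 3.6.11 (b) in the tree's corank form
(`SkinnerUrban2014.analyticRank_eq_zero_of_selmerCorank_eq_zero_of_mainConjecture`, below
`skinner_urban_main_conjecture` clause (2) and modularity `exists_isNewformOf`) gives
`ord_{s=1} L(E,s) = 0`. New relative to the Burungale–Castella–Skinner route of
`BSDSelmerPConverseRankZeroProofs` (`p ≥ 5`, (ram)-free): `p = 3` is allowed, at the price of (ram).
[cite: SkinnerUrban2014, Thm. 3.6.9 (p. 45) and Thm. 3.6.11 (b) (p. 46)]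
[cite: SilvermanAEC2009, Thm. X.4.2 (a)] -/
theorem rank_zero_and_analyticRank_zero_of_selmerGroup_eq_bot_of_skinnerUrban
    (hmod : exists_isNewformOf)
    (hSU : ∀ (W : WeierstrassCurve ℚ) [W.IsElliptic] [W.IsGloballyMinimal] (p : ℕ) [Fact p.Prime]
      (κ : ZpExtension ℚ p) (γ : Field.absoluteGaloisGroup ℚ) (N : ℕ) [NeZero N]
      (f : CuspForm (Gamma0 N) 2),
      skinner_urban_main_conjecture W p (κ := κ) (γ := γ) (f := f))
    (W : WeierstrassCurve ℚ) [W.IsElliptic] [W.IsGloballyMinimal] (p : ℕ) [Fact p.Prime]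
    (hp : 3 ≤ p) (hgood : W.HasGoodReductionAtPrime p) (hord : ¬ (p : ℤ) ∣ W.frobeniusTrace p)
    (hirr : W.HasIrreducibleModPGaloisRep p)
    (haux : ∃ ℓ : ℕ, ∃ _ : Fact ℓ.Prime, ℓ ≠ p ∧ W.HasMultiplicativeReductionAtPrime ℓ ∧
      ¬ p ∣ padicValInt ℓ W.minimalDiscriminantInt)
    (h : W.selmerGroup p = ⊥) :
    W.mordellWeilRank = 0 ∧ W.analyticRank = 0 ∧ AddCommGroup.primaryComponent W.sha p = ⊥ := by
  obtain ⟨hrank, hprim, hcorank⟩ := rank_zero_of_selmerGroup_eq_bot W p h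
  exact ⟨hrank, SkinnerUrban2014.analyticRank_eq_zero_of_selmerCorank_eq_zero_of_mainConjecture
    hmod hSU W p hp hgood hord hirr haux hcorank, hprim⟩

/-- **The density-binder currency: `#Sel^(p)(E/ℚ) = 1 ⟹ rank E(ℚ) = 0 ∧ ord_{s=1} L(E,s) = 0`**
(`p ≥ 3` good ordinary, (irr), (ram); below `skinner_urban_main_conjecture` clause (2) and
`exists_isNewformOf`) — the shape of the binder `h5` of `bsz_rankLeOne_cRank_of_pieces` at `p = 5`,
and of its `p = 3` analogue for the «second prime» count. [cite: SkinnerUrban2014, Thm. 3.6.11 (b) (p. 46)]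
[cite: BhargavaShankarTernary2015, §4.1 (proof of Thm. 41: "trivial 3-Selmer group, and therefore … rank 0")] -/
theorem rank_zero_and_analyticRank_zero_of_natCard_selmerGroup_eq_one_of_skinnerUrban
    (hmod : exists_isNewformOf)
    (hSU : ∀ (W : WeierstrassCurve ℚ) [W.IsElliptic] [W.IsGloballyMinimal] (p : ℕ) [Fact p.Prime]
      (κ : ZpExtension ℚ p) (γ : Field.absoluteGaloisGroup ℚ) (N : ℕ) [NeZero N]
      (f : CuspForm (Gamma0 N) 2),
      skinner_urban_main_conjecture W p (κ := κ) (γ := γ) (f := f))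
    (W : WeierstrassCurve ℚ) [W.IsElliptic] [W.IsGloballyMinimal] (p : ℕ) [Fact p.Prime]
    (hp : 3 ≤ p) (hgood : W.HasGoodReductionAtPrime p) (hord : ¬ (p : ℤ) ∣ W.frobeniusTrace p)
    (hirr : W.HasIrreducibleModPGaloisRep p)
    (haux : ∃ ℓ : ℕ, ∃ _ : Fact ℓ.Prime, ℓ ≠ p ∧ W.HasMultiplicativeReductionAtPrime ℓ ∧
      ¬ p ∣ padicValInt ℓ W.minimalDiscriminantInt)
    (h : Nat.card (W.selmerGroup p) = 1) :
    W.mordellWeilRank = 0 ∧ W.analyticRank = 0 := by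
  have hbot : W.selmerGroup p = ⊥ := by
    haveI := (Nat.card_eq_one_iff_unique.mp h).1
    exact (W.selmerGroup p).eq_bot_of_subsingleton
  obtain ⟨hrank, han, -⟩ := rank_zero_and_analyticRank_zero_of_selmerGroup_eq_bot_of_skinnerUrban
    hmod hSU W p hp hgood hord hirr haux hbot
  exact ⟨hrank, han⟩

/-! ### §3. The `p = 3` instance displayed (lever (γ)) -/

/-- **At `p = 3`: `#Sel^(3)(E/ℚ) = 1 ⟹ rank E(ℚ) = 0 ∧ ord_{s=1} L(E,s) = 0`** for `E/ℚ` good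
ordinary at `3` with `E[3]` irreducible and a multiplicative prime `ℓ` with `3 ∤ v_ℓ(Δ_min)` —
below `skinner_urban_main_conjecture` (A16; tier PUB* at `p = 3`, registry flag
`SU14-12.3.6-mu@nonsplit@3`, to be printed beside any number that depends on this theorem) and
`exists_isNewformOf`. This is the per-curve rank-`0` class theorem a «second prime `p = 3`» count
would consume on the blocks where `p = 5` is unavailable (additive at `5`, supersingular at `5`),
together with the tree's Bhargava–Shankar 3-Selmer average (`heightAverageOn_card_selmerThree_le_four`),
Dokchitser–Dokchitser parity (`even_selmerRank_sub_torsionRank_iff`) and the Markov step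
(`markov_step`). [cite: SkinnerUrban2014, Thm. 3.6.11 (b) (p. 46)]
[cite: BhargavaShankarTernary2015, Thm. 4 and §4.1] -/
theorem rank_zero_and_analyticRank_zero_of_natCard_selmerGroup_three_eq_one
    (hmod : exists_isNewformOf)
    (hSU : ∀ (W : WeierstrassCurve ℚ) [W.IsElliptic] [W.IsGloballyMinimal] (p : ℕ) [Fact p.Prime]
      (κ : ZpExtension ℚ p) (γ : Field.absoluteGaloisGroup ℚ) (N : ℕ) [NeZero N]
      (f : CuspForm (Gamma0 N) 2),
      skinner_urban_main_conjecture W p (κ := κ) (γ := γ) (f := f))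
    (W : WeierstrassCurve ℚ) [W.IsElliptic] [W.IsGloballyMinimal] [Fact (Nat.Prime 3)]
    (hgood : W.HasGoodReductionAtPrime 3) (hord : ¬ (3 : ℤ) ∣ W.frobeniusTrace 3)
    (hirr : W.HasIrreducibleModPGaloisRep 3)
    (haux : ∃ ℓ : ℕ, ∃ _ : Fact ℓ.Prime, ℓ ≠ 3 ∧ W.HasMultiplicativeReductionAtPrime ℓ ∧
      ¬ 3 ∣ padicValInt ℓ W.minimalDiscriminantInt)
    (h : Nat.card (W.selmerGroup 3) = 1) :
    W.mordellWeilRank = 0 ∧ W.analyticRank = 0 :=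
  rank_zero_and_analyticRank_zero_of_natCard_selmerGroup_eq_one_of_skinnerUrban hmod hSU W 3 le_rfl
    hgood (by exact_mod_cast hord) hirr haux (by exact_mod_cast h)

end Summit.BirchSwinnertonDyer.Rank1Residual.X10.RankZeroOfTrivialPSelmer

end
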